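import Summits.CriticalPhenomena.PercolationContinuityZ3.Theses.PercNearOneGluingNoHeavy
import Summits.CriticalPhenomena.PercolationContinuityZ3.Theorems.PercNearOneGluingAdditiveGluingGlue
import Literature.Probability.Percolation.KozmaNitzanTheorem6SlabCritical

/-!
# Near-one gluing implies `θ_{ℤ^d}(p_c) = 0` in every dimension `d ≥ 2`

Kozma–Nitzan's Theorem 6 — "if Conjecture 3 holds then `P_{p_c}(|C(0)| = ∞) = 0` on `ℤ^d` for every
`d ≥ 2`" — is the unconditional theorem `Literature.Probability.Percolation.KozmaNitzan2024_thm6_holds`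
(its slab input `θ_{S_k}(p_c(ℤ^d)) = 0` comes from the Barsky–Grimmett–Newman half-space theorem
`BarskyGrimmettNewman1991_holds`). This file applies it to the finite-graph gluing statements
`NearOneGluing`, `NoHeavyLowerTail` and `AdditiveGluing`:

* `nearOneGluing_iff_conjecture3` — `NearOneGluing` is, verbatim, Kozma–Nitzan's Conjecture 3
  (`Literature.Probability.Percolation.KozmaNitzan2024_conjecture3`);
* `percolationContinuity_of_nearOneGluing` — `NearOneGluing → ∀ d ≥ 2, PercolationContinuity d`;
* `percolationContinuity_of_noHeavyLowerTail` — the lower-tail statement `NoHeavyLowerTail` (no heavy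
  lower tail of `N = |C(o) ∩ A|` given a reliable relay set `A`) has the same consequence, through
  `noHeavyLowerTailGlue_proof : NoHeavyLowerTail → NearOneGluing`;
* `percolationContinuity_of_additiveGluing` — likewise for the additive gluing inequality
  `AdditiveGluing` (`P(o ↔ b) ≥ P(o ↔ A) − t` whenever `P(a ↔ b) ≥ 1 − t` for all `a ∈ A`), through
  `additiveGluingGlue_proof : AdditiveGluing → NearOneGluing`;
* `percolationContinuityZ3_of_nearOneGluing'` — the case `d = 3`.

[cite: KozmaNitzan2024, Conj. 3 and Thm. 6 (p. 15)]
-/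

namespace Summit.CriticalPhenomena.PercolationContinuityZ3.Theorems

open Summit.CriticalPhenomena.PercolationContinuityZ3.Theses
open Literature.Probability.Percolation

/-- `NearOneGluing` is verbatim Kozma–Nitzan's Conjecture 3 (arXiv:2401.12397, p. 15) as stated in
`Literature.Probability.Percolation.KozmaNitzan2024_conjecture3`. [cite: KozmaNitzan2024, Conj. 3 (p. 15)] -/
theorem nearOneGluing_iff_conjecture3 :
    PercNearOneGluingNoHeavy.NearOneGluing ↔ KozmaNitzan2024_conjecture3 :=
  Iff.rfl

/-- **Near-one gluing implies `θ_{ℤ^d}(p_c(ℤ^d)) = 0` for every `d ≥ 2`**: Kozma–Nitzan's Theorem 6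
(the unconditional theorem `KozmaNitzan2024_thm6_holds`) applied to `NearOneGluing`.
[cite: KozmaNitzan2024, Thm. 6 (p. 15)] -/
theorem percolationContinuity_of_nearOneGluing (hX : PercNearOneGluingNoHeavy.NearOneGluing)
    (d : ℕ) (hd : 2 ≤ d) : PercolationContinuity d :=
  KozmaNitzan2024_thm6_holds (nearOneGluing_iff_conjecture3.1 hX) d hd

/-- **The lower-tail statement implies `θ_{ℤ^d}(p_c(ℤ^d)) = 0` for every `d ≥ 2`**:
`noHeavyLowerTailGlue_proof : NoHeavyLowerTail → NearOneGluing` followed by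
`percolationContinuity_of_nearOneGluing`. -/
theorem percolationContinuity_of_noHeavyLowerTail (h : PercNearOneGluingNoHeavy.NoHeavyLowerTail)
    (d : ℕ) (hd : 2 ≤ d) : PercolationContinuity d :=
  percolationContinuity_of_nearOneGluing (noHeavyLowerTailGlue_proof h) d hd

/-- **The additive gluing inequality implies `θ_{ℤ^d}(p_c(ℤ^d)) = 0` for every `d ≥ 2`**:
`additiveGluingGlue_proof : AdditiveGluing → NearOneGluing` (take `δ = ε / 2`) followed by
`percolationContinuity_of_nearOneGluing`. -/
theorem percolationContinuity_of_additiveGluing (h : PercNearOneGluing.AdditiveGluing)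
    (d : ℕ) (hd : 2 ≤ d) : PercolationContinuity d :=
  percolationContinuity_of_nearOneGluing (additiveGluingGlue_proof h) d hd

/-- **The case `d = 3`**: `NearOneGluing` implies `θ(p_c) = 0` for bond percolation on `ℤ³`. -/
theorem percolationContinuityZ3_of_nearOneGluing' (hX : PercNearOneGluingNoHeavy.NearOneGluing) :
    _root_.PercolationContinuityZ3 :=
  percolationContinuity_of_nearOneGluing hX 3 (by norm_num)

end Summit.CriticalPhenomena.PercolationContinuityZ3.Theorems
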